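import Summits.BirchSwinnertonDyer.BirchSwinnertonDyer.Theorems.Rank2ObservatoryReductionWitnessT
import HarnessLib

/-!
# BirchSwinnertonDyer — rank ≥ 2 observatory: rank-2 kernel certificates for the torsion class `ℤ/8`

HONEST FRAMING: per-curve certified theorems and census instruments; no claim on BSD in rank ≥ 2.

The torsion-class certificates of `Rank2ObservatoryReductionWitnessT` handle `E(ℚ)[2^∞] ≅ ℤ/2`
(`two_le_mordellWeilRank_of_kernelCertT3`, `u = 1`) and `ℤ/4` (`…T4`, `u = 2`). Exactly two rows of
the rank-2 census below conductor `500000` (`253506bg3`, `308490bx1`) have `E(ℚ)_tors ≅ ℤ/8`, where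
`T̃₄ = 2T̃₈` is a double at every prime and the `ℤ/4` certificate has no witness. This file is the
`u = 3` level of the same ladder: from integral `T₈`, `T₄ = 2T₈` and `T = 2T₄` (integer tangent
certificates), `T₈' = T₈ + T₄ = 3T₈` (integer chord certificate), ONE good odd prime `ℓ₁` at which
`Ẽ(𝔽_ℓ₁)[8] = ⟨T̃₈⟩` (`twoTorsionOnlyB`, `halfTOnlyB`, and the new halves-of-`±T̃₄` test
`halfT4OnlyB`) and ONE good prime `ℓ₂` at which `T̃₈` is no double, we get `E(ℚ)[8] = ⟨T₈⟩`
(`eightTorsion_eq`, this file, with the abstract coset lemma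
`not_mem_twoCoset_three_of_eightTorsion_subset` and the `Ẽ(𝔽_q)[8]` enumeration `eq_of_halfT4OnlyB`);
the no-`16`-torsion lemma (which is where `ℓ₂` enters), the annihilator `8m`, the witness-form coset
lemma and the certificate `two_le_mordellWeilRank_of_kernelCertT8` are in `Rank2ObservatoryKernelCertT8`.
Integral points throughout. Sorry-free; no new axioms. References: Silverman AEC (2009) III.2.3, VII.3.1(b), VII.3.4, VIII.6.7; Cremona
(1997) §3.5.
-/

-- single-conjunct summit: `Summit.BirchSwinnertonDyer.BirchSwinnertonDyer.…` repeats the name by design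
set_option linter.dupNamespace false

namespace Summit.BirchSwinnertonDyer.BirchSwinnertonDyer.Rank2Observatory

open WeierstrassCurve Literature.NumberTheory.EllipticCurves

/-! ### Abstract coset lemma at `2`-exponent `u = 3` -/

section Abstract

variable {A : Type*} [AddCommGroup A]

/-- If `A[8] ⊆ {0, T, ±T₄, ±T₈, ±T₈'}` with `2T₄ = T`, `2T₈ = T₄`, `T₈' = T₈ + T₄`, and neither `x`
nor `x + T₈` lies in `2A`, then `x ∉ 2A + A[8]`. [folklore] -/
theorem not_mem_twoCoset_three_of_eightTorsion_subset {T T₄ T₈ T₈' x : A}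
    (h2T₄ : T₄ + T₄ = T) (h2T₈ : T₈ + T₈ = T₄) (h38 : T₈ + T₄ = T₈')
    (h8 : ∀ τ : A, (2 : ℤ) ^ 3 • τ = 0 →
      τ = 0 ∨ τ = T ∨ τ = T₄ ∨ τ = -T₄ ∨ τ = T₈ ∨ τ = -T₈ ∨ τ = T₈' ∨ τ = -T₈')
    (hx : x ∉ twoCoset A 0) (hxT : x + T₈ ∉ twoCoset A 0) : x ∉ twoCoset A 3 := by
  rintro ⟨b, c, hc, rfl⟩
  rcases h8 c hc with h | h | h | h | h | h | h | h <;> rw [h] at hx hxT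
  · exact hx ⟨b, 0, by rw [smul_zero], rfl⟩
  · apply hx
    refine ⟨b + T₄, 0, by rw [smul_zero], ?_⟩
    rw [add_zero, ← h2T₄, smul_add]
    abel
  · apply hx
    refine ⟨b + T₈, 0, by rw [smul_zero], ?_⟩
    rw [add_zero, ← h2T₈, smul_add]
    abel
  · apply hx
    refine ⟨b - T₈, 0, by rw [smul_zero], ?_⟩
    rw [add_zero, ← h2T₈, smul_sub]
    abel
  · apply hxT
    refine ⟨b + T₈, 0, by rw [smul_zero], ?_⟩
    rw [add_zero, smul_add]
    abel
  · apply hxT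
    refine ⟨b, 0, by rw [smul_zero], ?_⟩
    rw [add_zero]
    abel
  · apply hxT
    refine ⟨b + T₄, 0, by rw [smul_zero], ?_⟩
    rw [add_zero, ← h38, ← h2T₈, smul_add]
    abel
  · apply hxT
    refine ⟨b - T₈, 0, by rw [smul_zero], ?_⟩
    rw [add_zero, ← h38, ← h2T₈, smul_sub]
    abel

end Abstract

/-! ### The halves-of-`±T̃₄` test and `Ẽ(𝔽_q)[8]` -/

section HalfT4

variable (V : WeierstrassCurve ℤ)

/-- HALVES-OF-`±T₄` TEST (a Boolean for `decide`): every affine point `(β, γ)` of `Ẽ(𝔽_q)` with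
non-vertical tangent whose double has abscissa `x₄` (the duplication formula cleared of `D²`) is
`(x₈, ±y₈)` or `(x₈', ±y₈')`. [cite: SilvermanAEC2009, III.2.3] -/
def halfT4OnlyB (V : WeierstrassCurve ℤ) (q : ℕ) [NeZero q] (x₄ x₈ y₈ x₈' y₈' : ℤ) : Bool :=
  decide (∀ β γ : ZMod q,
    γ ^ 2 + (V.a₁ : ZMod q) * β * γ + (V.a₃ : ZMod q) * γ =
      β ^ 3 + (V.a₂ : ZMod q) * β ^ 2 + (V.a₄ : ZMod q) * β + (V.a₆ : ZMod q) →
    2 * γ + (V.a₁ : ZMod q) * β + (V.a₃ : ZMod q) ≠ 0 →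
    (x₄ : ZMod q) * (2 * γ + (V.a₁ : ZMod q) * β + (V.a₃ : ZMod q)) ^ 2 =
      (3 * β ^ 2 + 2 * (V.a₂ : ZMod q) * β + (V.a₄ : ZMod q) - (V.a₁ : ZMod q) * γ) ^ 2
        + (V.a₁ : ZMod q) * (3 * β ^ 2 + 2 * (V.a₂ : ZMod q) * β + (V.a₄ : ZMod q)
            - (V.a₁ : ZMod q) * γ) * (2 * γ + (V.a₁ : ZMod q) * β + (V.a₃ : ZMod q))
        - ((V.a₂ : ZMod q) + 2 * β) * (2 * γ + (V.a₁ : ZMod q) * β + (V.a₃ : ZMod q)) ^ 2 →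
    (β = (x₈ : ZMod q) ∧ (γ = (y₈ : ZMod q) ∨
      γ = -(y₈ : ZMod q) - (V.a₁ : ZMod q) * (x₈ : ZMod q) - (V.a₃ : ZMod q))) ∨
    (β = (x₈' : ZMod q) ∧ (γ = (y₈' : ZMod q) ∨
      γ = -(y₈' : ZMod q) - (V.a₁ : ZMod q) * (x₈' : ZMod q) - (V.a₃ : ZMod q))))

/-- Soundness of `twoTorsionOnlyB ∧ halfTOnlyB ∧ halfT4OnlyB` in `Ẽ(𝔽_q)`: a point `z` with
`8 • z = 0` is `O`, `T̃`, `±T̃₄`, `±T̃₈` or `±T̃₈'`. [cite: SilvermanAEC2009, III.2.3] -/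
theorem eq_of_halfT4OnlyB (q : ℕ) [Fact q.Prime] {xT yT x₄ y₄ x₈ y₈ x₈' y₈' : ℤ}
    (hT2 : 2 * yT + V.a₁ * xT + V.a₃ = 0)
    (h1 : twoTorsionOnlyB V q xT yT = true) (h2 : halfTOnlyB V q xT x₄ y₄ = true)
    (h3 : halfT4OnlyB V q x₄ x₈ y₈ x₈' y₈' = true)
    (h₄ : (V.map (Int.castRingHom (ZMod q))).toAffine.Nonsingular (x₄ : ZMod q) (y₄ : ZMod q))
    (h₈ : (V.map (Int.castRingHom (ZMod q))).toAffine.Nonsingular (x₈ : ZMod q) (y₈ : ZMod q))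
    (h₈' : (V.map (Int.castRingHom (ZMod q))).toAffine.Nonsingular (x₈' : ZMod q) (y₈' : ZMod q))
    (z : (V.map (Int.castRingHom (ZMod q))).toAffine.Point) (hz : 8 • z = 0) :
    z = 0 ∨ (∃ hns, z = Affine.Point.some (xT : ZMod q) (yT : ZMod q) hns) ∨
      z = Affine.Point.some (x₄ : ZMod q) (y₄ : ZMod q) h₄ ∨
      z = -Affine.Point.some (x₄ : ZMod q) (y₄ : ZMod q) h₄ ∨
      z = Affine.Point.some (x₈ : ZMod q) (y₈ : ZMod q) h₈ ∨
      z = -Affine.Point.some (x₈ : ZMod q) (y₈ : ZMod q) h₈ ∨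
      z = Affine.Point.some (x₈' : ZMod q) (y₈' : ZMod q) h₈' ∨
      z = -Affine.Point.some (x₈' : ZMod q) (y₈' : ZMod q) h₈' := by
  classical
  have ha₁ : (V.map (Int.castRingHom (ZMod q))).a₁ = (V.a₁ : ZMod q) := by
    simp [WeierstrassCurve.map]
  have ha₂ : (V.map (Int.castRingHom (ZMod q))).a₂ = (V.a₂ : ZMod q) := by
    simp [WeierstrassCurve.map]
  have ha₃ : (V.map (Int.castRingHom (ZMod q))).a₃ = (V.a₃ : ZMod q) := by
    simp [WeierstrassCurve.map]
  have ha₄ : (V.map (Int.castRingHom (ZMod q))).a₄ = (V.a₄ : ZMod q) := by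
    simp [WeierstrassCurve.map]
  have ha₆ : (V.map (Int.castRingHom (ZMod q))).a₆ = (V.a₆ : ZMod q) := by
    simp [WeierstrassCurve.map]
  have hz2 : 4 • (2 • z) = 0 := by rw [← mul_nsmul]; exact hz
  -- the four cases with `4 • z = 0` are those of `eq_of_halfTOnlyB`
  have small : 4 • z = 0 → z = 0 ∨ (∃ hns, z = Affine.Point.some (xT : ZMod q) (yT : ZMod q) hns) ∨
      z = Affine.Point.some (x₄ : ZMod q) (y₄ : ZMod q) h₄ ∨
      z = -Affine.Point.some (x₄ : ZMod q) (y₄ : ZMod q) h₄ ∨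
      z = Affine.Point.some (x₈ : ZMod q) (y₈ : ZMod q) h₈ ∨
      z = -Affine.Point.some (x₈ : ZMod q) (y₈ : ZMod q) h₈ ∨
      z = Affine.Point.some (x₈' : ZMod q) (y₈' : ZMod q) h₈' ∨
      z = -Affine.Point.some (x₈' : ZMod q) (y₈' : ZMod q) h₈' := by
    intro hz4
    rcases eq_of_halfTOnlyB V q h1 h2 h₄ z hz4 with h | h | h | h
    · exact Or.inl h
    · exact Or.inr (Or.inl h)
    · exact Or.inr (Or.inr (Or.inl h))
    · exact Or.inr (Or.inr (Or.inr (Or.inl h)))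
  rcases eq_of_halfTOnlyB V q h1 h2 h₄ (2 • z) hz2 with h0 | ⟨hns', hsome⟩ | hsome | hsome
  · -- `2z = 0`
    exact small (by rw [show (4 : ℕ) = 2 * 2 from rfl, mul_nsmul, h0, nsmul_zero])
  · -- `2z = T̃`, and `2T̃ = 0`
    have hTT : (Affine.Point.some (xT : ZMod q) (yT : ZMod q) hns' :
        (V.map (Int.castRingHom (ZMod q))).toAffine.Point) + .some (xT : ZMod q) (yT : ZMod q) hns' = 0 := by
      apply Affine.Point.add_self_of_Y_eq
      rw [Affine.negY, ha₁, ha₃]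
      have e : (2 : ZMod q) * (yT : ZMod q) + (V.a₁ : ZMod q) * (xT : ZMod q) + (V.a₃ : ZMod q) = 0 := by
        exact_mod_cast congrArg (fun n : ℤ => (n : ZMod q)) hT2
      linear_combination e
    exact small (by rw [show (4 : ℕ) = 2 * 2 from rfl, mul_nsmul, hsome, two_nsmul, hTT])
  all_goals
    -- `2z = ±T̃₄`: `z = (β, γ)` with non-vertical tangent and `x(2z) = x₄`
    simp only [halfT4OnlyB, decide_eq_true_eq] at h3
    rcases z with _ | ⟨β, γ, hns⟩
    · rw [← Affine.Point.zero_def, nsmul_zero] at hsome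
      exact absurd hsome.symm (Affine.Point.some_ne_zero _)
    · have heq : γ ^ 2 + (V.a₁ : ZMod q) * β * γ + (V.a₃ : ZMod q) * γ =
          β ^ 3 + (V.a₂ : ZMod q) * β ^ 2 + (V.a₄ : ZMod q) * β + (V.a₆ : ZMod q) := by
        have e := (Affine.equation_iff β γ).mp hns.left
        rwa [ha₁, ha₂, ha₃, ha₄, ha₆] at e
      by_cases hy : γ = (V.map (Int.castRingHom (ZMod q))).toAffine.negY β γ
      · rw [two_nsmul, Affine.Point.add_self_of_Y_eq hy] at hsome
        exact absurd hsome (Affine.Point.some_ne_zero _).symm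
      · rw [two_nsmul, Affine.Point.add_self_of_Y_ne hy] at hsome
        try rw [Affine.Point.neg_some] at hsome
        rw [Affine.Point.some.injEq] at hsome
        obtain ⟨hx, -⟩ := hsome
        have hDval : γ - (V.map (Int.castRingHom (ZMod q))).toAffine.negY β γ =
            2 * γ + (V.a₁ : ZMod q) * β + (V.a₃ : ZMod q) := by
          simp only [Affine.negY, ha₁, ha₃]; ring
        have hD' : 2 * γ + (V.a₁ : ZMod q) * β + (V.a₃ : ZMod q) ≠ 0 := by
          rw [← hDval]; exact sub_ne_zero.mpr hy
        have hLD : (V.map (Int.castRingHom (ZMod q))).toAffine.slope β β γ γ *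
            (2 * γ + (V.a₁ : ZMod q) * β + (V.a₃ : ZMod q)) =
            3 * β ^ 2 + 2 * (V.a₂ : ZMod q) * β + (V.a₄ : ZMod q) - (V.a₁ : ZMod q) * γ := by
          rw [Affine.slope_of_Y_ne rfl hy, hDval, ha₁, ha₂, ha₄]; exact div_mul_cancel₀ _ hD'
        have key : (x₄ : ZMod q) * (2 * γ + (V.a₁ : ZMod q) * β + (V.a₃ : ZMod q)) ^ 2 =
            (3 * β ^ 2 + 2 * (V.a₂ : ZMod q) * β + (V.a₄ : ZMod q) - (V.a₁ : ZMod q) * γ) ^ 2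
              + (V.a₁ : ZMod q) * (3 * β ^ 2 + 2 * (V.a₂ : ZMod q) * β + (V.a₄ : ZMod q)
                  - (V.a₁ : ZMod q) * γ) * (2 * γ + (V.a₁ : ZMod q) * β + (V.a₃ : ZMod q))
              - ((V.a₂ : ZMod q) + 2 * β) * (2 * γ + (V.a₁ : ZMod q) * β + (V.a₃ : ZMod q)) ^ 2 := by
          rw [← hx, ← hLD]
          simp only [Affine.addX, ha₁, ha₂]
          ring
        rcases h3 β γ heq hD' key with ⟨hβ, hγ⟩ | ⟨hβ, hγ⟩
        · subst hβ
          rcases hγ with rfl | rfl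
          · exact Or.inr (Or.inr (Or.inr (Or.inr (Or.inl rfl))))
          · right; right; right; right; right; left
            rw [Affine.Point.neg_some, Affine.Point.some.injEq]
            exact ⟨rfl, by rw [Affine.negY, ha₁, ha₃]⟩
        · subst hβ
          rcases hγ with rfl | rfl
          · exact Or.inr (Or.inr (Or.inr (Or.inr (Or.inr (Or.inr (Or.inl rfl))))))
          · right; right; right; right; right; right; right
            rw [Affine.Point.neg_some, Affine.Point.some.injEq]
            exact ⟨rfl, by rw [Affine.negY, ha₁, ha₃]⟩

end HalfT4

/-! ### `E(ℚ)[8] = ⟨T₈⟩` -/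

section EightTorsionWitness

variable (V : WeierstrassCurve ℤ)

open scoped Classical in
/-- **`E(ℚ)[8] = {O, T, ±T₄, ±T₈, ±T₈'}`** (`= ⟨T₈⟩`, `T₈' = 3T₈`) from integral points `T` (`2T = 0`),
`T₄` (`2T₄ = T`, `intTangent`), `T₈` (`2T₈ = T₄`, `intTangent`), `T₈' = T₈ + T₄` (`intChord`) and a good
odd prime `ℓ₁` with `twoTorsionOnlyB`, `halfTOnlyB`, `halfT4OnlyB`, by injectivity of reduction on
prime-to-`ℓ₁` torsion. [cite: SilvermanAEC2009, Prop. VII.3.1(b)] -/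
theorem eightTorsion_eq {xT yT x₄ y₄ x₈ y₈ x₈' y₈' : ℤ}
    (hT : yT ^ 2 + V.a₁ * xT * yT + V.a₃ * yT = xT ^ 3 + V.a₂ * xT ^ 2 + V.a₄ * xT + V.a₆)
    (hT2 : 2 * yT + V.a₁ * xT + V.a₃ = 0)
    (h₄ : y₄ ^ 2 + V.a₁ * x₄ * y₄ + V.a₃ * y₄ = x₄ ^ 3 + V.a₂ * x₄ ^ 2 + V.a₄ * x₄ + V.a₆)
    (htan₄ : intTangent V x₄ y₄ xT yT = true)
    (h₈ : y₈ ^ 2 + V.a₁ * x₈ * y₈ + V.a₃ * y₈ = x₈ ^ 3 + V.a₂ * x₈ ^ 2 + V.a₄ * x₈ + V.a₆)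
    (htan₈ : intTangent V x₈ y₈ x₄ y₄ = true)
    (h₈' : y₈' ^ 2 + V.a₁ * x₈' * y₈' + V.a₃ * y₈' = x₈' ^ 3 + V.a₂ * x₈' ^ 2 + V.a₄ * x₈' + V.a₆)
    (hchord : intChord V x₈ y₈ x₄ y₄ x₈' y₈' = true)
    (ℓ₁ : ℕ) [Fact ℓ₁.Prime] (hℓ₁ : ¬ (ℓ₁ : ℤ) ∣ V.Δ) (hodd : ℓ₁ ≠ 2)
    (hB₁ : twoTorsionOnlyB V ℓ₁ xT yT = true) (hB₂ : halfTOnlyB V ℓ₁ xT x₄ y₄ = true)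
    (hB₂' : halfT4OnlyB V ℓ₁ x₄ x₈ y₈ x₈' y₈' = true)
    (τ : (V.map (Int.castRingHom ℚ)).toAffine.Point) (hτ : (2 : ℤ) ^ 3 • τ = 0) :
    haveI := isElliptic_rat V (Δ_ne_zero_of_not_dvd V hℓ₁)
    τ = 0 ∨
      τ = Affine.Point.some (xT : ℚ) (yT : ℚ) (nonsingular_rat_of_eq V (Δ_ne_zero_of_not_dvd V hℓ₁) hT) ∨
      τ = Affine.Point.some (x₄ : ℚ) (y₄ : ℚ) (nonsingular_rat_of_eq V (Δ_ne_zero_of_not_dvd V hℓ₁) h₄) ∨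
      τ = -Affine.Point.some (x₄ : ℚ) (y₄ : ℚ) (nonsingular_rat_of_eq V (Δ_ne_zero_of_not_dvd V hℓ₁) h₄) ∨
      τ = Affine.Point.some (x₈ : ℚ) (y₈ : ℚ) (nonsingular_rat_of_eq V (Δ_ne_zero_of_not_dvd V hℓ₁) h₈) ∨
      τ = -Affine.Point.some (x₈ : ℚ) (y₈ : ℚ) (nonsingular_rat_of_eq V (Δ_ne_zero_of_not_dvd V hℓ₁) h₈) ∨
      τ = Affine.Point.some (x₈' : ℚ) (y₈' : ℚ) (nonsingular_rat_of_eq V (Δ_ne_zero_of_not_dvd V hℓ₁) h₈') ∨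
      τ = -Affine.Point.some (x₈' : ℚ) (y₈' : ℚ)
        (nonsingular_rat_of_eq V (Δ_ne_zero_of_not_dvd V hℓ₁) h₈') := by
  have hΔ : V.Δ ≠ 0 := Δ_ne_zero_of_not_dvd V hℓ₁
  haveI := isElliptic_rat V hΔ
  have hp : ℓ₁.Prime := Fact.out
  have hn : ¬ ℓ₁ ∣ 8 := fun hd =>
    hodd ((Nat.prime_dvd_prime_iff_eq hp Nat.prime_two).mp
      (hp.dvd_of_dvd_pow (by simpa using hd : ℓ₁ ∣ 2 ^ 3)))
  have eT : V.toAffine.Equation xT yT := (Affine.equation_iff xT yT).mpr hT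
  have e₄ : V.toAffine.Equation x₄ y₄ := (Affine.equation_iff x₄ y₄).mpr h₄
  have e₈ : V.toAffine.Equation x₈ y₈ := (Affine.equation_iff x₈ y₈).mpr h₈
  have e₈' : V.toAffine.Equation x₈' y₈' := (Affine.equation_iff x₈' y₈').mpr h₈'
  have hτ8 : 8 • τ = 0 := by
    have h : ((2 : ℤ) ^ 3) = ((8 : ℕ) : ℤ) := by norm_num
    rw [h, natCast_zsmul] at hτ; exact hτ
  set T : (V.map (Int.castRingHom ℚ)).toAffine.Point :=
    .some (xT : ℚ) (yT : ℚ) (nonsingular_rat_of_eq V hΔ hT) with hTdef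
  set T₄ : (V.map (Int.castRingHom ℚ)).toAffine.Point :=
    .some (x₄ : ℚ) (y₄ : ℚ) (nonsingular_rat_of_eq V hΔ h₄) with hT₄def
  set T₈ : (V.map (Int.castRingHom ℚ)).toAffine.Point :=
    .some (x₈ : ℚ) (y₈ : ℚ) (nonsingular_rat_of_eq V hΔ h₈) with hT₈def
  set T₈' : (V.map (Int.castRingHom ℚ)).toAffine.Point :=
    .some (x₈' : ℚ) (y₈' : ℚ) (nonsingular_rat_of_eq V hΔ h₈') with hT₈'def
  have h2T₄ : T₄ + T₄ = T := some_add_self_of_intTangent V hΔ h₄ hT htan₄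
  have h2T₈ : T₈ + T₈ = T₄ := some_add_self_of_intTangent V hΔ h₈ h₄ htan₈
  have h38 : T₈ + T₄ = T₈' := some_add_some_of_intChord V hΔ h₈ h₄ h₈' hchord
  have h2T : 2 • T = 0 := two_nsmul_some_eq_zero V hΔ hT hT2
  have h8T : 8 • T = 0 := by
    rw [show (8 : ℕ) = 2 * 2 * 2 from rfl, mul_nsmul, mul_nsmul, h2T, nsmul_zero, nsmul_zero]
  have h8T₄ : 8 • T₄ = 0 := by
    rw [show (8 : ℕ) = 2 * 2 * 2 from rfl, mul_nsmul, mul_nsmul, two_nsmul T₄, h2T₄, h2T, nsmul_zero]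
  have h8T₈ : 8 • T₈ = 0 := by
    rw [show (8 : ℕ) = 2 * 2 * 2 from rfl, mul_nsmul, mul_nsmul, two_nsmul T₈, h2T₈, two_nsmul T₄,
      h2T₄, h2T]
  have h8T₈' : 8 • T₈' = 0 := by rw [← h38, nsmul_add, h8T₈, h8T₄, add_zero]
  have hTred : ∀ hns, reduceMod V ℓ₁ hℓ₁ T = Affine.Point.some (xT : ZMod ℓ₁) (yT : ZMod ℓ₁) hns :=
    fun hns => by rw [hTdef, reduceMod_some V ℓ₁ hℓ₁ eT]
  have hT₄red : reduceMod V ℓ₁ hℓ₁ T₄ = Affine.Point.some (x₄ : ZMod ℓ₁) (y₄ : ZMod ℓ₁)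
      (nonsingular_zmod_of_equation V ℓ₁ hℓ₁ e₄) := by rw [hT₄def, reduceMod_some V ℓ₁ hℓ₁ e₄]
  have hT₈red : reduceMod V ℓ₁ hℓ₁ T₈ = Affine.Point.some (x₈ : ZMod ℓ₁) (y₈ : ZMod ℓ₁)
      (nonsingular_zmod_of_equation V ℓ₁ hℓ₁ e₈) := by rw [hT₈def, reduceMod_some V ℓ₁ hℓ₁ e₈]
  have hT₈'red : reduceMod V ℓ₁ hℓ₁ T₈' = Affine.Point.some (x₈' : ZMod ℓ₁) (y₈' : ZMod ℓ₁)
      (nonsingular_zmod_of_equation V ℓ₁ hℓ₁ e₈') := by rw [hT₈'def, reduceMod_some V ℓ₁ hℓ₁ e₈']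
  have hred : 8 • reduceMod V ℓ₁ hℓ₁ τ = 0 := by rw [← map_nsmul, hτ8, map_zero]
  -- injectivity of reduction on `8`-torsion: `τ̃ = R̃` with `8R = 0` gives `τ = R`
  have lift : ∀ R : (V.map (Int.castRingHom ℚ)).toAffine.Point, 8 • R = 0 →
      reduceMod V ℓ₁ hℓ₁ τ = reduceMod V ℓ₁ hℓ₁ R → τ = R := by
    intro R h8R he
    have hdiff0 : reduceMod V ℓ₁ hℓ₁ (τ - R) = 0 := by rw [map_sub, he, sub_self]
    have hdiff8 : 8 • (τ - R) = 0 := by rw [nsmul_sub, hτ8, h8R, sub_zero]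
    exact sub_eq_zero.mp (eq_zero_of_reduceMod_eq_zero V ℓ₁ hℓ₁ (τ - R) hn hdiff8 hdiff0)
  rcases eq_of_halfT4OnlyB V ℓ₁ hT2 hB₁ hB₂ hB₂' (nonsingular_zmod_of_equation V ℓ₁ hℓ₁ e₄)
      (nonsingular_zmod_of_equation V ℓ₁ hℓ₁ e₈) (nonsingular_zmod_of_equation V ℓ₁ hℓ₁ e₈') _ hred with
    h0 | ⟨hns, hsome⟩ | hsome | hsome | hsome | hsome | hsome | hsome
  · exact Or.inl (eq_zero_of_reduceMod_eq_zero V ℓ₁ hℓ₁ τ hn hτ8 h0)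
  · exact Or.inr (Or.inl (lift T h8T (by rw [hsome, hTred hns])))
  · exact Or.inr (Or.inr (Or.inl (lift T₄ h8T₄ (by rw [hsome, hT₄red]))))
  · refine Or.inr (Or.inr (Or.inr (Or.inl (lift (-T₄) ?_ (by rw [hsome, map_neg, hT₄red])))))
    rw [neg_nsmul, h8T₄, neg_zero]
  · exact Or.inr (Or.inr (Or.inr (Or.inr (Or.inl (lift T₈ h8T₈ (by rw [hsome, hT₈red]))))))
  · refine Or.inr (Or.inr (Or.inr (Or.inr (Or.inr (Or.inl (lift (-T₈) ?_
      (by rw [hsome, map_neg, hT₈red])))))))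
    rw [neg_nsmul, h8T₈, neg_zero]
  · exact Or.inr (Or.inr (Or.inr (Or.inr (Or.inr (Or.inr (Or.inl
      (lift T₈' h8T₈' (by rw [hsome, hT₈'red]))))))))
  · refine Or.inr (Or.inr (Or.inr (Or.inr (Or.inr (Or.inr (Or.inr (lift (-T₈') ?_
      (by rw [hsome, map_neg, hT₈'red]))))))))
    rw [neg_nsmul, h8T₈', neg_zero]

end EightTorsionWitness

end Summit.BirchSwinnertonDyer.BirchSwinnertonDyer.Rank2Observatory
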